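/-
Copyright (c) 2026 the pub-hodgecm-mathlib formalisation cell (harness21).  Prover seat hodgecm-mathlib-K2Liu-p13 (g2), Track B «K2-LIT»,
#184♮ = hLiu418 = `stmt-HodgeConjecture-24832`; Road I v3 organ U1-CT-ind STAGE 2 (Q2), file F5-a (LEAD F0P6-plan (g14) 10:39:33Z ∕ 11:15:51Z «F4 → F5 → D-U1 stage 3 =»).
-/
import Summits.HodgeConjecture.HodgeConjecture.Theorems.K2LiuKlingenCellXiOrbits               -- ★ F4-3b: orbit representatives, invariant, stabilisers (+ ★ F4, F4-3a)
import Summits.HodgeConjecture.HodgeConjecture.Theorems.K2LiuSiegelQuotSubgroupOrbitSum         -- ★ F4-2c: `tsum_orbit_eq_integral_wt_smul_conj`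
import Summits.HodgeConjecture.HodgeConjecture.Theorems.K2LiuConstantTermMiddleCellPrelims      -- ★ α3-1 (K2Liu-p10): `hasSum_tsum_subtype_of_eq_iUnion`
import HarnessLib

/-!
# Crux `HLiu418`, Road I v3, organ U1 stage 2 (Q2), file F5-a: THE `ξ`-CELL OF THE Q-CONSTANT TERM AS A SUM OVER `B₂(L⁺)\U(J₂)(L⁺)` OF LEVI-TRANSPORTED
# INTERTWINING-TYPE INTEGRALS — `Σ'_{x ∈ C₁ᶜ} ∫ β • f(γ_x u h) = Σ_{[g′]} ∫ β₁(u) • f(Ψ(ξ) u Ψ(m_Q(1,g′)) h) dνN(u)`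

Cell `hodgecm-mathlib`, crux item hLiu418 = `stmt-HodgeConjecture-24832`; squad K2 ∕ K2Liu; LEAD F0P6-plan (g14), co-dealer K2E5-plan (g7); prover K2Liu-p13 (g2).
THEOREMS ONLY (no `def`, no instance, no notation, no named-fact hypothesis, no `sorry`); lane `--supports stmt-HodgeConjecture-24832 --as helper` (count-neutral).
`n = 2`; ★ F3's transport clauses BY VALUE (section variables).  SETTING of ★ F4 `klingenConstTerm_two_cells`: `N_Q(𝔸) = klingenUnipA Ψ` with a left-invariant `νN`,
an `N_Q(L⁺)`-covering weight `β`, a continuous Siegel section `f`, `h ∈ H(𝔸)`, the binder (H), the identity cell `C₁` (membership law BY VALUE); its `ξ`-cell term is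
`Σ'_{x ∈ C₁ᶜ} ∫ β(u) • f(γ_x u h) dνN`.  INPUTS BY VALUE (all dischargeable, none named facts): a ROW SECTION `g : I → U(J₂)(L⁺)` of `B₂(L⁺)\U(J₂)(L⁺)` (`hcov`: every
`g′` has `(g′ (g i)⁻¹)₁₀ = 0` for some `i`; `hsep`: distinct indices are `B₂`-inequivalent), the stabiliser `Γ₁ = Stab(⟦Ψ(ξ)⟧) ∩ N_Q(L⁺)` (membership law; `= Ψ(u₊(L⁺))` by
★ F4-3b `isSiegelDelta_conj_transport_iff_exists_uPlus` at `m = 1`) with ONE `Γ₁`-covering weight `β₁`, and the unimodularity binders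
`hconj i : MeasurePreserving (u ↦ Ψ(m_i) u Ψ(m_i)⁻¹) νN νN`, `m_i = m_Q(1, g i)` RATIONAL (product formula; ★ α3-2's `hconj`).  THEN (**`hasSum_cellXi`**)
  `HasSum (i ↦ ∫ β₁(u) • f(Ψ(ξ) · u · Ψ(m_i) · h) dνN(u)) (Σ'_{x ∈ C₁ᶜ} ∫ β(u) • f(γ_x u h) dνN(u))`.
PROOF.  `C₁ᶜ = ⨆_i O_i`, `O_i = {⟦Ψ(ξ m_i) ν⟧ : ν ∈ N_Q(L⁺)}` (★ F4-3b: every ξ-class is `⟦Ψ(ξ m_Q(1,g′) n)⟧`, `hcov` + `mk_weylXi_klingenLevi_eq_of_apply_one_zero` move it to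
`O_i`; `apply_one_zero_eq_zero_of_mk_eq_mk` + `hsep` separate the `O_i`; `mem_orbit_iff`); ★ α3-1 `hasSum_tsum_subtype_of_eq_iUnion` regroups the absolutely convergent
series (★ F4-2a); each orbit is `∫ β₁ • f(Ψ(ξ) u Ψ(m_i) h)` by ★ F4-2c `tsum_orbit_eq_integral_wt_smul_conj` (`P = Ψ(m_i)` normalises `N_Q(𝔸)`, ★ F4-1f).
NEXT (F5-b/c): identity cell `Σ'_{x ∈ C₁} f(γ_x h) = Σ_{[g′]} f(Ψ(m_Q(1,g′)) h)`; coordinates∕Haar on `N_Q(𝔸)` to integrate `u₊(L⁺)\u₊(𝔸)` out of `∫ β₁ • f(Ψ(ξ) u x)`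
(`= vol · M(ξ,s)f(x)`); restriction to `h = Ψ(m_Q(a,g′)) h₀` and E1's Borel Eisenstein series by name.
[MoeglinWaldspurger1995, II.1.7], [Xiong2013, §4 Prop. 4.1, §7 L. 7.1], [GanTakeda2011SiegelWeil, §7.2 p. 23], [KudlaRallis1994, §2], [Garrett2018, §3.10].
HONEST LABEL.  Count-neutral helper: `HC_CM` is proved only modulo the 7 printed citations (2 remaining named inputs: hLiu418 = `stmt-HodgeConjecture-24832`,
h413 = `stmt-HodgeConjecture-24833`) until rung 0 closes.
-/

set_option autoImplicit false
set_option linter.dupNamespace false -- the mandated namespace repeats `HodgeConjecture.HodgeConjecture`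

noncomputable section

open scoped Matrix ENNReal NNReal
open NumberField IsDedekindDomain MeasureTheory MeasureTheory.Measure Filter Set Function

namespace Summit.HodgeConjecture.HodgeConjecture.Cruxes.HLiu418.K2LiuKlingenCellXiOrbitSum

open Literature.NumberTheory.Automorphic Literature.NumberTheory.Automorphic.UnitaryGroup
open Literature.NumberTheory.GelbartRogawski1991 Literature.NumberTheory.GelbartRogawski1991.GRConstruction
open Literature.NumberTheory.GaloisRepresentations
open Literature.NumberTheory.K2Lit.SiegelDoubled Literature.MeasureTheory.Group
open Summit.HodgeConjecture.HodgeConjecture.Cruxes.HLiu418.K2LiuDoubledUTwoTwoBorelFrame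
open Summit.HodgeConjecture.HodgeConjecture.Cruxes.HLiu418.K2LiuKlingenParabolicDefs
open Summit.HodgeConjecture.HodgeConjecture.Cruxes.HLiu418.K2LiuKlingenUnipotentDefs
open Summit.HodgeConjecture.HodgeConjecture.Cruxes.HLiu418.K2LiuKlingenUnipotentAdelicDefs
open Summit.HodgeConjecture.HodgeConjecture.Cruxes.HLiu418.K2LiuKlingenRationalCells
open Summit.HodgeConjecture.HodgeConjecture.Cruxes.HLiu418.K2LiuKlingenCellOneConstant (conj_mem_klingenUnipA)
open Summit.HodgeConjecture.HodgeConjecture.Cruxes.HLiu418.K2LiuSiegelBruhatMiddleCellDelta (mk_eq_mk_iff_isSiegelDelta)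
open Summit.HodgeConjecture.HodgeConjecture.Cruxes.HLiu418.K2LiuKlingenConstantTermUnfold (mem_compl_cellOne_iff)
open Summit.HodgeConjecture.HodgeConjecture.Cruxes.HLiu418.K2LiuKlingenCellXiOrbits
open Summit.HodgeConjecture.HodgeConjecture.Cruxes.HLiu418.K2LiuSiegelEisensteinSubgroupPeriodCells
open Summit.HodgeConjecture.HodgeConjecture.Cruxes.HLiu418.K2LiuSiegelQuotSubgroupOrbitSum
open Summit.HodgeConjecture.HodgeConjecture.Cruxes.HLiu418.K2LiuConstantTermMiddleCellPrelims (hasSum_tsum_subtype_of_eq_iUnion)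
open UnitaryDualPair

variable {L : Type} [Field L] [NumberField L] [IsCMField L]
variable {N M : ℕ} {e : Fin N × Fin M ≃ Fin 2}
  {dV : Fin N → L} {hdV : ∀ i, IsCMField.complexConj L (dV i) = dV i}
  {dW : Fin M → L} {hdW : ∀ i, IsCMField.complexConj L (dW i) = dW i}

/-! ## §0 Class bookkeeping -/

/-- classes of elements of `H(L⁺)` with equal values in `H(𝔸)` coincide. [cite: MoeglinWaldspurger1995, II.1.7] -/
theorem mk_eq_mk_of_coe_eq {a b : ratH L e dV hdV dW hdW} (h : (a : HA L e dV hdV dW hdW) = b) :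
    (Quotient.mk (MulAction.orbitRel (siegelDeltaRat L e dV hdV dW hdW) (ratH L e dV hdV dW hdW)) a : SiegelDeltaQuot L e dV hdV dW hdW) =
      Quotient.mk (MulAction.orbitRel (siegelDeltaRat L e dV hdV dW hdW) (ratH L e dV hdV dW hdW)) b := by
  rw [Subtype.ext h]

/-- **the right action of `H(L⁺)` on `P_Δ(L⁺)\H(L⁺)` is well defined**: `⟦a⟧ = ⟦b⟧ ⟹ ⟦a c⟧ = ⟦b c⟧`. [cite: MoeglinWaldspurger1995, II.1.7] -/
theorem mk_mul_eq_mk_mul_of_mk_eq {a b : ratH L e dV hdV dW hdW} (c : ratH L e dV hdV dW hdW)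
    (h : (Quotient.mk (MulAction.orbitRel (siegelDeltaRat L e dV hdV dW hdW) (ratH L e dV hdV dW hdW)) a : SiegelDeltaQuot L e dV hdV dW hdW) =
      Quotient.mk (MulAction.orbitRel (siegelDeltaRat L e dV hdV dW hdW) (ratH L e dV hdV dW hdW)) b) :
    (Quotient.mk (MulAction.orbitRel (siegelDeltaRat L e dV hdV dW hdW) (ratH L e dV hdV dW hdW)) (a * c) : SiegelDeltaQuot L e dV hdV dW hdW) =
      Quotient.mk (MulAction.orbitRel (siegelDeltaRat L e dV hdV dW hdW) (ratH L e dV hdV dW hdW)) (b * c) := by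
  rw [mk_eq_mk_iff_isSiegelDelta] at h ⊢
  have hrew : ((b * c : ratH L e dV hdV dW hdW) : HA L e dV hdV dW hdW) * (((a * c : ratH L e dV hdV dW hdW) : HA L e dV hdV dW hdW))⁻¹ =
      (b : HA L e dV hdV dW hdW) * ((a : HA L e dV hdV dW hdW))⁻¹ := by
    rw [Subgroup.coe_mul, Subgroup.coe_mul, mul_inv_rev, ← mul_assoc, mul_assoc (b : HA L e dV hdV dW hdW), mul_inv_cancel, mul_one]
  rw [hrew]
  exact h

section Transport

variable {SA : GL (Fin (2 + 2)) (AdeleRing (𝓞 L) L)}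
  {Ψ : (quasiSplit (Fp L) L (IsCMField.complexConj L) (2 + 2)).Adelic ≃ₜ* HA L e dV hdV dW hdW} {X Y : Matrix (Fin 2) (Fin 2) (Fp L)} {a : Fp L}
  (hΨ : ∀ g : (quasiSplit (Fp L) L (IsCMField.complexConj L) (2 + 2)).Adelic,
    (((Ψ g : HA L e dV hdV dW hdW) : GL (Fin (2 + 2)) (AdeleRing (𝓞 L) L)) : Matrix (Fin (2 + 2)) (Fin (2 + 2)) (AdeleRing (𝓞 L) L)) =
      (SA : Matrix (Fin (2 + 2)) (Fin (2 + 2)) (AdeleRing (𝓞 L) L)) *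
        ((adelicVal (Fp L) L (IsCMField.complexConj L) (2 + 2) _ g : GL (Fin (2 + 2)) (AdeleRing (𝓞 L) L)) :
          Matrix (Fin (2 + 2)) (Fin (2 + 2)) (AdeleRing (𝓞 L) L)) *
        ((SA⁻¹ : GL (Fin (2 + 2)) (AdeleRing (𝓞 L) L)) : Matrix (Fin (2 + 2)) (Fin (2 + 2)) (AdeleRing (𝓞 L) L)))
  (ha : a + a = 1)
  (hSA : Matrix.reindex (e₂ (n := 2)).symm (e₂ (n := 2)).symm (SA : Matrix (Fin (2 + 2)) (Fin (2 + 2)) (AdeleRing (𝓞 L) L)) =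
    Matrix.fromBlocks (1 : Matrix (Fin 2) (Fin 2) (AdeleRing (𝓞 L) L)) (X.map ((algebraMap L (AdeleRing (𝓞 L) L)).comp (algebraMap (Fp L) L))) 1
      (-(X.map ((algebraMap L (AdeleRing (𝓞 L) L)).comp (algebraMap (Fp L) L)))))
  (hSAi : Matrix.reindex (e₂ (n := 2)).symm (e₂ (n := 2)).symm ((SA⁻¹ : GL (Fin (2 + 2)) (AdeleRing (𝓞 L) L)) : Matrix (Fin (2 + 2)) (Fin (2 + 2)) (AdeleRing (𝓞 L) L)) =
    Matrix.fromBlocks ((a • (1 : Matrix (Fin 2) (Fin 2) (Fp L))).map ((algebraMap L (AdeleRing (𝓞 L) L)).comp (algebraMap (Fp L) L)))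
      ((a • (1 : Matrix (Fin 2) (Fin 2) (Fp L))).map ((algebraMap L (AdeleRing (𝓞 L) L)).comp (algebraMap (Fp L) L)))
      (Y.map ((algebraMap L (AdeleRing (𝓞 L) L)).comp (algebraMap (Fp L) L)))
      (-(Y.map ((algebraMap L (AdeleRing (𝓞 L) L)).comp (algebraMap (Fp L) L)))))
  (hΨP : ∀ b : (quasiSplit (Fp L) L (IsCMField.complexConj L) (2 + 2)).Adelic,
    ((adelicVal (Fp L) L (IsCMField.complexConj L) (2 + 2) _ b : GL (Fin (2 + 2)) (AdeleRing (𝓞 L) L)) :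
        Matrix (Fin (2 + 2)) (Fin (2 + 2)) (AdeleRing (𝓞 L) L)).BlockTriangular id →
      IsSiegelDelta L e dV hdV dW hdW (Ψ b))
  (hXY : X * Y = a • (1 : Matrix (Fin 2) (Fin 2) (Fp L))) (hYX : Y * X = a • (1 : Matrix (Fin 2) (Fin 2) (Fp L)))

/-! ## §1 The orbit sets `O(γ₁ P)` of the `ξ`-cell, in ★ F4-3b's currency -/

include hΨ ha hSA hSAi hXY hYX in
/-- **membership in the orbit set of `⟦Ψ(ξ m)⟧`** (`m ∈ Q(L⁺)`, orbit spelled as in ★ F4-2c with `γ₁ = Ψ(ξ)`, `P = Ψ(m)`): `x ∈ O ⟺ x = ⟦Ψ(ξ · m · n)⟧` for some `n ∈ N_Q(L⁺)`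
(★ F4-3b `exists_mem_klingenUnip_of_mem_ratH` ∕ `transport_toAdelic_mem_klingenUnipA`). [cite: MoeglinWaldspurger1995, II.1.7] [cite: Xiong2013, §7 Lemma 7.1] -/
theorem mem_orbit_iff {γ₁ P : ratH L e dV hdV dW hdW} {m : unitaryGroupOfForm ((IsCMField.complexConj L : L ≃ₐ[Fp L] L) : L →+* L) ((StdForm.antidiagonal 4).over L)}
    (hγ₁ : (γ₁ : HA L e dV hdV dW hdW) = Ψ (UnitaryGroup.toAdelic (Fp L) L (IsCMField.complexConj L) (2 + 2) ((StdForm.antidiagonal (2 + 2)).over L)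
      (weylXi L ((IsCMField.complexConj L : L ≃ₐ[Fp L] L) : L →+* L))))
    (hP : (P : HA L e dV hdV dW hdW) = Ψ (UnitaryGroup.toAdelic (Fp L) L (IsCMField.complexConj L) (2 + 2) ((StdForm.antidiagonal (2 + 2)).over L) m))
    (x : SiegelDeltaQuot L e dV hdV dW hdW) :
    x ∈ Set.range (fun γ : (ratH L e dV hdV dW hdW).subgroupOf (klingenUnipA Ψ) =>
        (Quotient.mk (MulAction.orbitRel (siegelDeltaRat L e dV hdV dW hdW) (ratH L e dV hdV dW hdW))
          (⟨((γ₁ * P : ratH L e dV hdV dW hdW) : HA L e dV hdV dW hdW) * ((γ : ↥(klingenUnipA Ψ)) : HA L e dV hdV dW hdW),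
            mul_mem (γ₁ * P).2 (coe_coe_mem_ratH γ)⟩ : ratH L e dV hdV dW hdW) : SiegelDeltaQuot L e dV hdV dW hdW)) ↔
      ∃ n ∈ klingenUnip L ((IsCMField.complexConj L : L ≃ₐ[Fp L] L) : L →+* L) (complexConj_ringHom_apply_apply L), ∃ γ : ratH L e dV hdV dW hdW,
        (γ : HA L e dV hdV dW hdW) = Ψ (UnitaryGroup.toAdelic (Fp L) L (IsCMField.complexConj L) (2 + 2) ((StdForm.antidiagonal (2 + 2)).over L)
          (weylXi L ((IsCMField.complexConj L : L ≃ₐ[Fp L] L) : L →+* L) * (m * n))) ∧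
        x = Quotient.mk (MulAction.orbitRel (siegelDeltaRat L e dV hdV dW hdW) (ratH L e dV hdV dW hdW)) γ := by
  have hval : ∀ n : unitaryGroupOfForm ((IsCMField.complexConj L : L ≃ₐ[Fp L] L) : L →+* L) ((StdForm.antidiagonal 4).over L),
      ((γ₁ * P : ratH L e dV hdV dW hdW) : HA L e dV hdV dW hdW) *
          Ψ (UnitaryGroup.toAdelic (Fp L) L (IsCMField.complexConj L) (2 + 2) ((StdForm.antidiagonal (2 + 2)).over L) n) =
        Ψ (UnitaryGroup.toAdelic (Fp L) L (IsCMField.complexConj L) (2 + 2) ((StdForm.antidiagonal (2 + 2)).over L)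
          (weylXi L ((IsCMField.complexConj L : L ≃ₐ[Fp L] L) : L →+* L) * (m * n))) := fun n => by
    rw [transport_toAdelic_mul, transport_toAdelic_mul, Subgroup.coe_mul, hγ₁, hP, mul_assoc]
  constructor
  · rintro ⟨γ, rfl⟩
    obtain ⟨n, hn, hγn⟩ := exists_mem_klingenUnip_of_mem_ratH hΨ ha hSA hSAi hXY hYX (γ : ↥(klingenUnipA Ψ)).2 (coe_coe_mem_ratH γ)
    refine ⟨n, hn, ⟨_, transport_toAdelic_mem_ratH hΨ ha hSA hSAi hXY hYX _⟩, rfl, mk_eq_mk_of_coe_eq ?_⟩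
    show ((γ₁ * P : ratH L e dV hdV dW hdW) : HA L e dV hdV dW hdW) * ((γ : ↥(klingenUnipA Ψ)) : HA L e dV hdV dW hdW) = _
    rw [hγn, hval]
  · rintro ⟨n, hn, γ, hγ, rfl⟩
    refine ⟨⟨⟨_, transport_toAdelic_mem_klingenUnipA hn⟩, Subgroup.mem_subgroupOf.2 (transport_toAdelic_mem_ratH hΨ ha hSA hSAi hXY hYX n)⟩,
      mk_eq_mk_of_coe_eq ?_⟩
    rw [hγ]
    exact hval n

/-! ## §2 The `ξ`-cell as a `HasSum` over a row section of `B₂(L⁺)\U(J₂)(L⁺)` -/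

include hΨ ha hSA hSAi hXY hYX in
/-- **(Q2) F5-a — THE `ξ`-CELL OF THE Q-CONSTANT TERM IS THE SUM, OVER `B₂(L⁺)\U(J₂)(L⁺)`, OF THE LEVI-TRANSPORTED INTERTWINING-TYPE INTEGRALS.**
`νN` left-invariant on `N_Q(𝔸) = klingenUnipA Ψ`; `β` an `N_Q(L⁺)`-covering weight; `f` a continuous Siegel section of `I_Δ(s,χ)`; `h ∈ H(𝔸)`; (H); `C₁` the identity cell (membership law);
`g : I → U(J₂)(L⁺)` a row section of `B₂(L⁺)\U(J₂)(L⁺)` (`hcov`, `hsep`); `Γ₁ = Stab(⟦Ψ ξ⟧) ∩ N_Q(L⁺)` (membership law) with a `Γ₁`-covering weight `β₁`; and the unimodularity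
binders `hconj i : MeasurePreserving (u ↦ Ψ(m_i) u Ψ(m_i)⁻¹) νN νN`, `m_i = m_Q(1, g i)`.  THEN
  `HasSum (i ↦ ∫ β₁(u) • f(Ψ(ξ) · u · (Ψ(m_i) · h)) dνN(u)) (Σ'_{x ∈ C₁ᶜ} ∫ β(u) • f(γ_x · (u · h)) dνN(u))`.
(`C₁ᶜ = ⨆_i O(Ψ(ξ)Ψ(m_i))` by ★ F4-3b; ★ α3-1 regroups; each orbit by ★ F4-2c `tsum_orbit_eq_integral_wt_smul_conj`, `Ψ(m_i)^{±1}` normalising `N_Q(𝔸)` by ★ F4-1f.)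
[cite: MoeglinWaldspurger1995, II.1.7] [cite: Xiong2013, §4 Prop. 4.1] [cite: GanTakeda2011SiegelWeil, §7.2 p. 23] [cite: KudlaRallis1994, §2] [cite: Garrett2018, §3.10] -/
theorem hasSum_cellXi [MeasurableSpace ↥(klingenUnipA Ψ)] [BorelSpace ↥(klingenUnipA Ψ)] (νN : Measure ↥(klingenUnipA Ψ)) [νN.IsMulLeftInvariant]
    {β : ↥(klingenUnipA Ψ) → ℝ≥0∞} (hβ : IsCoveringWeight ((ratH L e dV hdV dW hdW).subgroupOf (klingenUnipA Ψ)) β)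
    {χ : HeckeCharacter L} {s : ℂ} {f : HA L e dV hdV dW hdW → ℂ} (hf : IsSiegelDeltaSection L e dV hdV dW hdW χ s f) (hfc : Continuous f)
    (h : HA L e dV hdV dW hdW)
    (hH : ∫⁻ u, (∑' x : SiegelDeltaQuot L e dV hdV dW hdW,
        ‖f ((((Quotient.out x : ratH L e dV hdV dW hdW) : HA L e dV hdV dW hdW)) * ((u : HA L e dV hdV dW hdW) * h))‖ₑ) * β u ∂νN ≠ ∞)
    (C₁ : Set (SiegelDeltaQuot L e dV hdV dW hdW))
    (hC₁ : ∀ x, x ∈ C₁ ↔ ∃ q ∈ klingen L ((IsCMField.complexConj L : L ≃ₐ[Fp L] L) : L →+* L), ∃ γ : ratH L e dV hdV dW hdW,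
      (γ : HA L e dV hdV dW hdW) = Ψ (UnitaryGroup.toAdelic (Fp L) L (IsCMField.complexConj L) (2 + 2) ((StdForm.antidiagonal (2 + 2)).over L) q) ∧
        x = Quotient.mk (MulAction.orbitRel (siegelDeltaRat L e dV hdV dW hdW) (ratH L e dV hdV dW hdW)) γ)
    {I : Type*} (g : I → unitaryGroupOfForm ((IsCMField.complexConj L : L ≃ₐ[Fp L] L) : L →+* L) ((StdForm.antidiagonal 2).over L))
    (hcov : ∀ g' : unitaryGroupOfForm ((IsCMField.complexConj L : L ≃ₐ[Fp L] L) : L →+* L) ((StdForm.antidiagonal 2).over L),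
      ∃ i, (((g' * (g i)⁻¹ : unitaryGroupOfForm ((IsCMField.complexConj L : L ≃ₐ[Fp L] L) : L →+* L) ((StdForm.antidiagonal 2).over L)) : GL (Fin 2) L) :
        Matrix (Fin 2) (Fin 2) L) 1 0 = 0)
    (hsep : ∀ i j, (((g j * (g i)⁻¹ : unitaryGroupOfForm ((IsCMField.complexConj L : L ≃ₐ[Fp L] L) : L →+* L) ((StdForm.antidiagonal 2).over L)) : GL (Fin 2) L) :
        Matrix (Fin 2) (Fin 2) L) 1 0 = 0 → i = j)
    (Γ₁ : Subgroup ↥(klingenUnipA Ψ))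
    (hΓ₁ : ∀ u : ↥(klingenUnipA Ψ), u ∈ Γ₁ ↔ (u : HA L e dV hdV dW hdW) ∈ ratH L e dV hdV dW hdW ∧
      IsSiegelDelta L e dV hdV dW hdW
        (Ψ (UnitaryGroup.toAdelic (Fp L) L (IsCMField.complexConj L) (2 + 2) ((StdForm.antidiagonal (2 + 2)).over L)
            (weylXi L ((IsCMField.complexConj L : L ≃ₐ[Fp L] L) : L →+* L))) * (u : HA L e dV hdV dW hdW) *
          (Ψ (UnitaryGroup.toAdelic (Fp L) L (IsCMField.complexConj L) (2 + 2) ((StdForm.antidiagonal (2 + 2)).over L)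
            (weylXi L ((IsCMField.complexConj L : L ≃ₐ[Fp L] L) : L →+* L))))⁻¹))
    {β₁ : ↥(klingenUnipA Ψ) → ℝ≥0∞} (hβ₁ : IsCoveringWeight Γ₁ β₁)
    (hconj : ∀ i, MeasurePreserving (fun u : ↥(klingenUnipA Ψ) =>
      (⟨Ψ (UnitaryGroup.toAdelic (Fp L) L (IsCMField.complexConj L) (2 + 2) ((StdForm.antidiagonal (2 + 2)).over L)
            (klingenLevi L ((IsCMField.complexConj L : L ≃ₐ[Fp L] L) : L →+* L) (complexConj_ringHom_apply_apply L) 1 (g i))) * (u : HA L e dV hdV dW hdW) *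
          (Ψ (UnitaryGroup.toAdelic (Fp L) L (IsCMField.complexConj L) (2 + 2) ((StdForm.antidiagonal (2 + 2)).over L)
            (klingenLevi L ((IsCMField.complexConj L : L ≃ₐ[Fp L] L) : L →+* L) (complexConj_ringHom_apply_apply L) 1 (g i))))⁻¹,
        conj_mem_klingenUnipA Ψ (klingenLevi_mem_klingen (complexConj_ringHom_apply_apply L) 1 (g i)) u.2⟩ : ↥(klingenUnipA Ψ))) νN νN) :
    HasSum (fun i => ∫ u, (β₁ u).toReal •
        f (Ψ (UnitaryGroup.toAdelic (Fp L) L (IsCMField.complexConj L) (2 + 2) ((StdForm.antidiagonal (2 + 2)).over L)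
              (weylXi L ((IsCMField.complexConj L : L ≃ₐ[Fp L] L) : L →+* L))) * (u : HA L e dV hdV dW hdW) *
            (Ψ (UnitaryGroup.toAdelic (Fp L) L (IsCMField.complexConj L) (2 + 2) ((StdForm.antidiagonal (2 + 2)).over L)
              (klingenLevi L ((IsCMField.complexConj L : L ≃ₐ[Fp L] L) : L →+* L) (complexConj_ringHom_apply_apply L) 1 (g i))) * h)) ∂νN)
      (∑' x : ↥(C₁ᶜ), ∫ u, (β u).toReal • f ((((Quotient.out (x : SiegelDeltaQuot L e dV hdV dW hdW) : ratH L e dV hdV dW hdW) :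
          HA L e dV hdV dW hdW)) * ((u : HA L e dV hdV dW hdW) * h)) ∂νN) := by
  classical
  -- the rational letters `γ₁ = Ψ(ξ)` and `P i = Ψ(m_Q(1, g i))` in `H(L⁺)`, kept opaque with their value equations
  obtain ⟨γ₁, hγ₁⟩ : ∃ γ₁ : ratH L e dV hdV dW hdW, (γ₁ : HA L e dV hdV dW hdW) =
      Ψ (UnitaryGroup.toAdelic (Fp L) L (IsCMField.complexConj L) (2 + 2) ((StdForm.antidiagonal (2 + 2)).over L)
        (weylXi L ((IsCMField.complexConj L : L ≃ₐ[Fp L] L) : L →+* L))) := ⟨⟨_, transport_toAdelic_mem_ratH hΨ ha hSA hSAi hXY hYX _⟩, rfl⟩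
  obtain ⟨P, hPe⟩ : ∃ P : I → ratH L e dV hdV dW hdW, ∀ i, (P i : HA L e dV hdV dW hdW) =
      Ψ (UnitaryGroup.toAdelic (Fp L) L (IsCMField.complexConj L) (2 + 2) ((StdForm.antidiagonal (2 + 2)).over L)
        (klingenLevi L ((IsCMField.complexConj L : L ≃ₐ[Fp L] L) : L →+* L) (complexConj_ringHom_apply_apply L) 1 (g i))) :=
    ⟨fun i => ⟨_, transport_toAdelic_mem_ratH hΨ ha hSA hSAi hXY hYX _⟩, fun i => rfl⟩
  -- the series of integrals and its summability (★ F4-2a)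
  set J : SiegelDeltaQuot L e dV hdV dW hdW → ℂ := fun x =>
    ∫ u, (β u).toReal • f ((((Quotient.out x : ratH L e dV hdV dW hdW) : HA L e dV hdV dW hdW)) * ((u : HA L e dV hdV dW hdW) * h)) ∂νN with hJdef
  have hJ : Summable J := summable_integral_wt_smul_apply_out νN hβ.1 hβ.le_one hfc h hH
  -- the orbit sets
  set O : I → Set (SiegelDeltaQuot L e dV hdV dW hdW) := fun i =>
    Set.range (fun γ : (ratH L e dV hdV dW hdW).subgroupOf (klingenUnipA Ψ) =>
      (Quotient.mk (MulAction.orbitRel (siegelDeltaRat L e dV hdV dW hdW) (ratH L e dV hdV dW hdW))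
        (⟨((γ₁ * P i : ratH L e dV hdV dW hdW) : HA L e dV hdV dW hdW) * ((γ : ↥(klingenUnipA Ψ)) : HA L e dV hdV dW hdW),
          mul_mem (γ₁ * P i).2 (coe_coe_mem_ratH γ)⟩ : ratH L e dV hdV dW hdW) : SiegelDeltaQuot L e dV hdV dW hdW)) with hOdef
  have hmemO : ∀ i x, x ∈ O i ↔
      ∃ n ∈ klingenUnip L ((IsCMField.complexConj L : L ≃ₐ[Fp L] L) : L →+* L) (complexConj_ringHom_apply_apply L), ∃ γ : ratH L e dV hdV dW hdW,
        (γ : HA L e dV hdV dW hdW) = Ψ (UnitaryGroup.toAdelic (Fp L) L (IsCMField.complexConj L) (2 + 2) ((StdForm.antidiagonal (2 + 2)).over L)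
          (weylXi L ((IsCMField.complexConj L : L ≃ₐ[Fp L] L) : L →+* L) *
            (klingenLevi L ((IsCMField.complexConj L : L ≃ₐ[Fp L] L) : L →+* L) (complexConj_ringHom_apply_apply L) 1 (g i) * n))) ∧
        x = Quotient.mk (MulAction.orbitRel (siegelDeltaRat L e dV hdV dW hdW) (ratH L e dV hdV dW hdW)) γ :=
    fun i x => mem_orbit_iff hΨ ha hSA hSAi hXY hYX hγ₁ (hPe i) x
  -- `C₁ᶜ = ⋃ i, O i`
  have hRO : C₁ᶜ = ⋃ i, O i := by
    ext x
    rw [Set.mem_iUnion]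
    constructor
    · intro hx
      obtain ⟨g', n, hn, hx'⟩ := exists_levi_unip_of_mem_compl_cellOne hΨ ha hSA hSAi hXY hYX C₁ hC₁ hx
      obtain ⟨i, hi⟩ := hcov g'
      refine ⟨i, (hmemO i x).2 ⟨n, hn, ⟨_, transport_toAdelic_mem_ratH hΨ ha hSA hSAi hXY hYX _⟩, rfl, ?_⟩⟩
      rw [hx']
      -- `⟦Ψ(ξ m′ n)⟧ = ⟦Ψ(ξ m′)⟧·Ψ(n) = ⟦Ψ(ξ m_i)⟧·Ψ(n) = ⟦Ψ(ξ m_i n)⟧`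
      have hcls := mk_mul_eq_mk_mul_of_mk_eq
        (⟨Ψ (UnitaryGroup.toAdelic (Fp L) L (IsCMField.complexConj L) (2 + 2) ((StdForm.antidiagonal (2 + 2)).over L) n),
          transport_toAdelic_mem_ratH hΨ ha hSA hSAi hXY hYX n⟩ : ratH L e dV hdV dW hdW)
        (mk_weylXi_klingenLevi_eq_of_apply_one_zero hΨ ha hSA hSAi hXY hYX (g₁ := g i) (g₂ := g') hi)
      refine (mk_eq_mk_of_coe_eq ?_).trans (hcls.trans (mk_eq_mk_of_coe_eq ?_))
      · show Ψ _ = Ψ _ * Ψ _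
        rw [← transport_toAdelic_mul, mul_assoc]
      · show Ψ _ * Ψ _ = Ψ _
        rw [← transport_toAdelic_mul, mul_assoc]
    · rintro ⟨i, hx⟩
      obtain ⟨n, hn, γ, hγ, rfl⟩ := (hmemO i x).1 hx
      exact (mem_compl_cellOne_iff hΨ ha hSA hSAi hXY hYX C₁ hC₁ _).2
        ⟨_, (klingen L _).mul_mem (klingenLevi_mem_klingen _ 1 (g i)) (klingenUnip_le_klingen _ hn), γ, hγ, rfl⟩
  -- the `O i` are pairwise disjoint
  have hdisj : Pairwise (Disjoint on O) := by
    intro i j hij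
    refine Set.disjoint_left.2 fun x hxi hxj => hij ?_
    obtain ⟨n, hn, γ, hγ, rfl⟩ := (hmemO i x).1 hxi
    obtain ⟨n', hn', γ', hγ', hγγ'⟩ := (hmemO j _).1 hxj
    have hγe : γ = ⟨_, transport_toAdelic_mem_ratH hΨ ha hSA hSAi hXY hYX
        (weylXi L ((IsCMField.complexConj L : L ≃ₐ[Fp L] L) : L →+* L) *
          (klingenLevi L ((IsCMField.complexConj L : L ≃ₐ[Fp L] L) : L →+* L) (complexConj_ringHom_apply_apply L) 1 (g i) * n))⟩ := Subtype.ext hγ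
    have hγe' : γ' = ⟨_, transport_toAdelic_mem_ratH hΨ ha hSA hSAi hXY hYX
        (weylXi L ((IsCMField.complexConj L : L ≃ₐ[Fp L] L) : L →+* L) *
          (klingenLevi L ((IsCMField.complexConj L : L ≃ₐ[Fp L] L) : L →+* L) (complexConj_ringHom_apply_apply L) 1 (g j) * n'))⟩ := Subtype.ext hγ'
    rw [hγe, hγe'] at hγγ'
    exact hsep i j (apply_one_zero_eq_zero_of_mk_eq_mk hΨ ha hSA hSAi hXY hYX hn hn' hγγ')
  -- regrouping the absolutely convergent series along `C₁ᶜ = ⨆ O i`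
  have hsum := hasSum_tsum_subtype_of_eq_iUnion hJ hRO hdisj
  -- each orbit: ★ F4-2c `tsum_orbit_eq_integral_wt_smul_conj`
  have hPn : ∀ i, ∀ u : HA L e dV hdV dW hdW, u ∈ klingenUnipA Ψ → (P i : HA L e dV hdV dW hdW) * u * ((P i : HA L e dV hdV dW hdW))⁻¹ ∈ klingenUnipA Ψ :=
    fun i u hu => by rw [hPe i]; exact conj_mem_klingenUnipA Ψ (klingenLevi_mem_klingen _ 1 (g i)) hu
  have hPn' : ∀ i, ∀ u : HA L e dV hdV dW hdW, u ∈ klingenUnipA Ψ → ((P i : HA L e dV hdV dW hdW))⁻¹ * u * (P i : HA L e dV hdV dW hdW) ∈ klingenUnipA Ψ := by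
    intro i u hu
    have h1 := conj_mem_klingenUnipA Ψ ((klingen L _).inv_mem (klingenLevi_mem_klingen (complexConj_ringHom_apply_apply L) 1 (g i))) hu
    rw [transport_toAdelic_inv, inv_inv, ← hPe i] at h1
    exact h1
  have hΓ₁' : ∀ u : ↥(klingenUnipA Ψ), u ∈ Γ₁ ↔ (u : HA L e dV hdV dW hdW) ∈ ratH L e dV hdV dW hdW ∧
      IsSiegelDelta L e dV hdV dW hdW ((γ₁ : HA L e dV hdV dW hdW) * (u : HA L e dV hdV dW hdW) * ((γ₁ : HA L e dV hdV dW hdW))⁻¹) := by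
    intro u; rw [hγ₁]; exact hΓ₁ u
  have hconj' : ∀ i, MeasurePreserving (fun u : ↥(klingenUnipA Ψ) =>
      (⟨(P i : HA L e dV hdV dW hdW) * (u : HA L e dV hdV dW hdW) * ((P i : HA L e dV hdV dW hdW))⁻¹, hPn i _ u.2⟩ : ↥(klingenUnipA Ψ))) νN νN := by
    intro i
    have hfeq : (fun u : ↥(klingenUnipA Ψ) =>
        (⟨(P i : HA L e dV hdV dW hdW) * (u : HA L e dV hdV dW hdW) * ((P i : HA L e dV hdV dW hdW))⁻¹, hPn i _ u.2⟩ : ↥(klingenUnipA Ψ))) =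
        fun u : ↥(klingenUnipA Ψ) =>
      (⟨Ψ (UnitaryGroup.toAdelic (Fp L) L (IsCMField.complexConj L) (2 + 2) ((StdForm.antidiagonal (2 + 2)).over L)
            (klingenLevi L ((IsCMField.complexConj L : L ≃ₐ[Fp L] L) : L →+* L) (complexConj_ringHom_apply_apply L) 1 (g i))) * (u : HA L e dV hdV dW hdW) *
          (Ψ (UnitaryGroup.toAdelic (Fp L) L (IsCMField.complexConj L) (2 + 2) ((StdForm.antidiagonal (2 + 2)).over L)
            (klingenLevi L ((IsCMField.complexConj L : L ≃ₐ[Fp L] L) : L →+* L) (complexConj_ringHom_apply_apply L) 1 (g i))))⁻¹,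
        conj_mem_klingenUnipA Ψ (klingenLevi_mem_klingen (complexConj_ringHom_apply_apply L) 1 (g i)) u.2⟩ : ↥(klingenUnipA Ψ)) :=
      funext fun u => Subtype.ext (by simp only [hPe i])
    rw [hfeq]
    exact hconj i
  have key : ∀ i, ∑' q : ↥(O i), J q = ∫ u, (β₁ u).toReal •
      f ((γ₁ : HA L e dV hdV dW hdW) * (u : HA L e dV hdV dW hdW) * ((P i : HA L e dV hdV dW hdW) * h)) ∂νN := fun i =>
    tsum_orbit_eq_integral_wt_smul_conj νN hβ hf hfc γ₁ (P i) h (hPn i) (hPn' i) Γ₁ hΓ₁' hβ₁ (hconj' i)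
      (lintegral_tsum_subtype_enorm_mul_ne_top νN β f h hH _)
  have hfun : (fun i => ∑' q : ↥(O i), J q) = fun i => ∫ u, (β₁ u).toReal •
      f (Ψ (UnitaryGroup.toAdelic (Fp L) L (IsCMField.complexConj L) (2 + 2) ((StdForm.antidiagonal (2 + 2)).over L)
            (weylXi L ((IsCMField.complexConj L : L ≃ₐ[Fp L] L) : L →+* L))) * (u : HA L e dV hdV dW hdW) *
          (Ψ (UnitaryGroup.toAdelic (Fp L) L (IsCMField.complexConj L) (2 + 2) ((StdForm.antidiagonal (2 + 2)).over L)
            (klingenLevi L ((IsCMField.complexConj L : L ≃ₐ[Fp L] L) : L →+* L) (complexConj_ringHom_apply_apply L) 1 (g i))) * h)) ∂νN := by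
    funext i; rw [key i, hγ₁, hPe i]
  rw [hfun] at hsum
  exact hsum

end Transport

end Summit.HodgeConjecture.HodgeConjecture.Cruxes.HLiu418.K2LiuKlingenCellXiOrbitSum

end
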